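import Summits.CriticalPhenomena.PercolationContinuityZ3.Theorems.PercNearOneGluingNoHeavyQuantLongTailTripleHubAlg
import HarnessLib

/-!
# QUANT lane R8, T-DEC: LONG-TAIL TRIPLE HUB, `7lo/2 ≤ K ≤ 4lo` — closed forms of the TOP route, TWO LOWS (census-1 gen 33)

builds on p205010 (kernel theorem, internal audit signed; external expert review pending)

Support file (`--supports stmt-CriticalPhenomena-4575`), QUANT lane seat prim-quant-census-1 (gen 33); memo
`run/shared/lean/prim/quant/prim-quant-census-1/g33/WIDE3-G33.md` §2.  Theorems only, standard axioms, no sorries.  Pure real-polynomial inequalities: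
the twins, for `lo/K ∈ [1/4, 2/7]` (`7lo ≤ 2K ≤ 8lo`), of gen 32's top-route certificates `ltTop_*` (`…QuantLongTailTripleTopAlg*`, `lo/K ∈ [2/7, 1/3]`) of
the THREE-BRANCH rule for the width-3 hub `S(γ₁)∗S(γ₂)∗S(γ₃)` of shape `{lo, lo+K; γ}` (one low `3lo`: `3lo+K` while the credit lasts, else `3lo+2K`
while its capacity lasts, else the top; two lows: both to the top).  Notation: `u₀ = (1−g₁)(1−g₂)(1−g₃)`, `u₁ = Σ gᵢ(1−gⱼ)(1−gₖ)`, `u₂ = Σ gᵢgⱼ(1−gₖ)`,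
`u₃ = g₁g₂g₃`; `T = 6lo + D`, rate `ρ = D/(3K)`.  Certificates (nonnegative combinations of products of the box atoms `Kgᵢ−lo, 1−gᵢ, g₂−g₁, g₃−g₁,
4lo−K, 2K−7lo` and the premises) found by kit j298285 (`g33/code/kitjob5` = gen 32's finder with `c ∈ [1/4, 2/7]`: scipy/HiGHS float LP for the
support + exact rational repair) and checked here by `linarith`.  The `K ≤ 4lo` forms used by the route files are the case splits `ltTopW_*`
(`…QuantLongTailTripleTopAlgW4`).
* `ltTop4_capRho_two` (`D(u₀+u₁+u₃) ≤ 3K·u₃`), `ltTop4_capTop_two` (two-low floor capacity), `ltTop4_costRho_two` (ρ-cost, two lows).  The floor cost at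
  `T = 6lo+2K` (`Cc2`, degree ≥ 6) is `…TopAlgFourThree`.
NUMERICS (memo §1): every inequality holds with 0 failures on exact gate grids for `c ∈ {1/4, 13/50, 27/100, 7/25, 2/7}` (`g33/code/exp2_c3top_cc2.py`,
`exp1_threebranch.py` on 18 shapes up to `K = 4.5lo`).

HONEST STATUS.  Algebra only; `SiblingStep`, `GluedDominatedMass`, `SDECConvClosed`, `FarTreeRow` OPEN; RATE class (log\*) / honest sentence of
`run/shared/lean/prim/quant/README.md` unchanged.  [this work].  Nothing here is cited as a published result.  The gluing rows served
[cite: KozmaNitzan2024, Conjecture 3 (p. 15)]; product measure [cite: Grimmett1999, §1.3 p. 10].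
-/

noncomputable section

namespace Summit.CriticalPhenomena.PercolationContinuityZ3.Theorems
namespace Quant
namespace LawDec

/-- **top capacity, ρ-part, two lows, `7lo ≤ 2K ≤ 8lo`** (`2K ≤ D ≤ K(g₁+g₂+g₃) − 3lo`): `D(u₀+u₁+u₃) ≤ 3K·u₃`. Degree-4 certificate, 39 products
(kit j298271/j298285). [this work] -/
theorem ltTop4_capRho_two (lo K g₁ g₂ g₃ D : ℝ) (hlo : 0 < lo)
    (hK1 : 7 * lo ≤ 2 * K) (hK2 : K ≤ 4 * lo) (hg₁ : lo ≤ K * g₁) (hg₂ : lo ≤ K * g₂) (hg₃ : lo ≤ K * g₃) (h11 : g₁ ≤ 1)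
    (h21 : g₂ ≤ 1) (h31 : g₃ ≤ 1) (hD2' : 2 * K ≤ D) (hDL' : D ≤ K * (g₁ + g₂ + g₃) - 3 * lo) :
    D * ((1 - g₁) * (1 - g₂) * (1 - g₃) + (g₁ * (1 - g₂) * (1 - g₃) + g₂ * (1 - g₁) * (1 - g₃) + g₃ * (1 - g₁) * (1 - g₂)) + (g₁ * g₂ * g₃))
      ≤ 3 * K * (g₁ * g₂ * g₃) := by
  have hK : 0 < K := by linarith
  have hA1 : 0 ≤ K * g₁ - lo := sub_nonneg.2 hg₁
  have hA2 : 0 ≤ K * g₂ - lo := sub_nonneg.2 hg₂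
  have hA3 : 0 ≤ K * g₃ - lo := sub_nonneg.2 hg₃
  have hE1 : 0 ≤ 1 - g₁ := sub_nonneg.2 h11
  have hE2 : 0 ≤ 1 - g₂ := sub_nonneg.2 h21
  have hE3 : 0 ≤ 1 - g₃ := sub_nonneg.2 h31
  have hClo : 0 ≤ 4 * lo - K := by linarith
  have hChi : 0 ≤ 2 * K - 7 * lo := by linarith
  have hD2 : 0 ≤ D - 2 * K := by linarith
  have hDL : 0 ≤ K * (g₁ + g₂ + g₃) - 3 * lo - D := sub_nonneg.2 hDL'
  have key : 0 ≤ K ^ 2 * (3 * K * (g₁ * g₂ * g₃)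
      - (D * ((1 - g₁) * (1 - g₂) * (1 - g₃) + (g₁ * (1 - g₂) * (1 - g₃) + g₂ * (1 - g₁) * (1 - g₃) + g₃ * (1 - g₁) * (1 - g₂))
          + (g₁ * g₂ * g₃)))) := by
    linarith [mul_nonneg (mul_nonneg hK.le hK.le) hK.le,
      mul_nonneg (mul_nonneg hDL hK.le) hK.le,
      mul_nonneg (mul_nonneg hClo hK.le) hK.le,
      mul_nonneg (mul_nonneg hClo hChi) hK.le,
      mul_nonneg (mul_nonneg (mul_nonneg hE3 hDL) hK.le) hK.le,
      mul_nonneg (mul_nonneg (mul_nonneg hE3 hClo) hK.le) hK.le,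
      mul_nonneg (mul_nonneg (mul_nonneg hE3 hClo) hD2) hK.le,
      mul_nonneg (mul_nonneg (mul_nonneg hE2 hDL) hK.le) hK.le,
      mul_nonneg (mul_nonneg (mul_nonneg hE2 hClo) hK.le) hK.le,
      mul_nonneg (mul_nonneg (mul_nonneg hE2 hClo) hD2) hK.le,
      mul_nonneg (mul_nonneg (mul_nonneg (mul_nonneg hE2 hE3) hDL) hK.le) hK.le,
      mul_nonneg (mul_nonneg (mul_nonneg (mul_nonneg (mul_nonneg hE2 hE3) hE3) hK.le) hK.le) hK.le,
      mul_nonneg (mul_nonneg (mul_nonneg (mul_nonneg (mul_nonneg hE2 hE2) hE3) hK.le) hK.le) hK.le,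
      mul_nonneg (mul_nonneg (mul_nonneg hE1 hDL) hK.le) hK.le,
      mul_nonneg (mul_nonneg (mul_nonneg hE1 hClo) hK.le) hK.le,
      mul_nonneg (mul_nonneg (mul_nonneg hE1 hClo) hD2) hK.le,
      mul_nonneg (mul_nonneg (mul_nonneg (mul_nonneg hE1 hE3) hChi) hD2) hK.le,
      mul_nonneg (mul_nonneg (mul_nonneg (mul_nonneg hE1 hE2) hDL) hK.le) hK.le,
      mul_nonneg (mul_nonneg (mul_nonneg (mul_nonneg (mul_nonneg hE1 hE2) hE3) hK.le) hK.le) hK.le,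
      mul_nonneg (mul_nonneg (mul_nonneg (mul_nonneg (mul_nonneg hE1 hE2) hE3) hD2) hK.le) hK.le,
      mul_nonneg (mul_nonneg (mul_nonneg (mul_nonneg (mul_nonneg hE1 hE1) hE2) hK.le) hK.le) hK.le,
      mul_nonneg (mul_nonneg (mul_nonneg hA3 hE2) hD2) hK.le,
      mul_nonneg (mul_nonneg (mul_nonneg hA3 hE2) hClo) hK.le,
      mul_nonneg (mul_nonneg (mul_nonneg hA3 hE1) hD2) hK.le,
      mul_nonneg (mul_nonneg (mul_nonneg hA3 hE1) hClo) hK.le,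
      mul_nonneg (mul_nonneg hA3 hA3) hK.le,
      mul_nonneg (mul_nonneg (mul_nonneg hA2 hE3) hD2) hK.le,
      mul_nonneg (mul_nonneg (mul_nonneg hA2 hE3) hClo) hK.le,
      mul_nonneg (mul_nonneg (mul_nonneg hA2 hE3) hClo) hD2,
      mul_nonneg (mul_nonneg (mul_nonneg hA2 hE1) hD2) hK.le,
      mul_nonneg (mul_nonneg (mul_nonneg hA2 hA3) hE1) hK.le,
      mul_nonneg (mul_nonneg hA2 hA2) hK.le,
      mul_nonneg (mul_nonneg (mul_nonneg hA2 hA2) hE1) hK.le,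
      mul_nonneg (mul_nonneg (mul_nonneg hA1 hE3) hClo) hK.le,
      mul_nonneg (mul_nonneg (mul_nonneg hA1 hE2) hD2) hK.le,
      mul_nonneg (mul_nonneg (mul_nonneg hA1 hA3) hE2) hK.le,
      mul_nonneg (mul_nonneg (mul_nonneg hA1 hA2) hE3) hK.le,
      mul_nonneg (mul_nonneg (mul_nonneg hA1 hA2) hE3) hD2,
      mul_nonneg (mul_nonneg hA1 hA1) hK.le]
  by_contra hc; push Not at hc
  have := mul_neg_of_pos_of_neg (pow_pos hK 2) (show 3 * K * (g₁ * g₂ * g₃) - (D * ((1 - g₁) * (1 - g₂) * (1 - g₃) + (g₁ * (1 - g₂) * (1 - g₃)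
          + g₂ * (1 - g₁) * (1 - g₃) + g₃ * (1 - g₁) * (1 - g₂)) + (g₁ * g₂ * g₃))) < 0 by linarith)
  linarith

/-- **top capacity, floor part, two lows, `7lo ≤ 2K ≤ 8lo`** (`g₁` the least gate, `2K ≤ K(g₁+g₂+g₃) − 3lo`): `(lo+Kg₁)(u₀+u₁+u₃) ≤ (lo+K)u₃`.
Degree-4 certificate, 21 products (kit j298271/j298285). [this work] -/
theorem ltTop4_capTop_two (lo K g₁ g₂ g₃ : ℝ) (hlo : 0 < lo)
    (hK1 : 7 * lo ≤ 2 * K) (hK2 : K ≤ 4 * lo) (hg₁ : lo ≤ K * g₁) (hg₂ : lo ≤ K * g₂) (hg₃ : lo ≤ K * g₃) (h12 : g₁ ≤ g₂)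
    (h13 : g₁ ≤ g₃) (h11 : g₁ ≤ 1) (h21 : g₂ ≤ 1) (h31 : g₃ ≤ 1) (hL2' : 2 * K ≤ K * (g₁ + g₂ + g₃) - 3 * lo) :
    (lo + K * g₁) * ((1 - g₁) * (1 - g₂) * (1 - g₃) + (g₁ * (1 - g₂) * (1 - g₃) + g₂ * (1 - g₁) * (1 - g₃) + g₃ * (1 - g₁) * (1 - g₂))
          + (g₁ * g₂ * g₃))
      ≤ (lo + K) * (g₁ * g₂ * g₃) := by
  have hK : 0 < K := by linarith
  have hA1 : 0 ≤ K * g₁ - lo := sub_nonneg.2 hg₁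
  have hA2 : 0 ≤ K * g₂ - lo := sub_nonneg.2 hg₂
  have hA3 : 0 ≤ K * g₃ - lo := sub_nonneg.2 hg₃
  have hE1 : 0 ≤ 1 - g₁ := sub_nonneg.2 h11
  have hE2 : 0 ≤ 1 - g₂ := sub_nonneg.2 h21
  have hE3 : 0 ≤ 1 - g₃ := sub_nonneg.2 h31
  have h21' : 0 ≤ g₂ - g₁ := sub_nonneg.2 h12
  have h31' : 0 ≤ g₃ - g₁ := sub_nonneg.2 h13
  have hClo : 0 ≤ 4 * lo - K := by linarith
  have hChi : 0 ≤ 2 * K - 7 * lo := by linarith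
  have hL2 : 0 ≤ K * (g₁ + g₂ + g₃) - 3 * lo - 2 * K := by linarith
  have key : 0 ≤ ((lo + K) * (g₁ * g₂ * g₃)
      - ((lo + K * g₁) * ((1 - g₁) * (1 - g₂) * (1 - g₃) + (g₁ * (1 - g₂) * (1 - g₃) + g₂ * (1 - g₁) * (1 - g₃) + g₃ * (1 - g₁) * (1 - g₂))
          + (g₁ * g₂ * g₃)))) := by
    linarith [mul_nonneg h31' hA3,
      mul_nonneg h21' hA2,
      mul_nonneg (mul_nonneg h21' h21') hK.le,
      mul_nonneg hE3 hL2,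
      mul_nonneg hE3 hA2,
      mul_nonneg hE3 hClo,
      mul_nonneg hE2 hL2,
      mul_nonneg hE2 hA3,
      mul_nonneg hE2 hClo,
      mul_nonneg (mul_nonneg hE2 hE3) hChi,
      mul_nonneg hE1 hL2,
      mul_nonneg hE1 hA2,
      mul_nonneg hE1 hClo,
      mul_nonneg (mul_nonneg hE1 hE3) hChi,
      mul_nonneg (mul_nonneg hE1 hE2) hChi,
      mul_nonneg (mul_nonneg (mul_nonneg hE1 hE2) hE3) hK.le,
      mul_nonneg (mul_nonneg (mul_nonneg hE1 hE2) hE3) hClo,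
      mul_nonneg (mul_nonneg (mul_nonneg hE1 hE1) hE3) hK.le,
      mul_nonneg (mul_nonneg (mul_nonneg hE1 hE1) hE2) hA3,
      mul_nonneg (mul_nonneg (mul_nonneg hE1 hE1) hE2) hClo,
      mul_nonneg (mul_nonneg (mul_nonneg hA1 hE1) hE2) hE3]
  linarith [key]

/-- **top cost, ρ-part, two lows, `7lo ≤ 2K ≤ 8lo`** (`2K ≤ D ≤ K(g₁+g₂+g₃) − 3lo`): `(3K−3lo−D)·D·(u₀+u₁) ≤ (3K−D)(u₀(D+3lo) + u₁(D+3lo−K)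
          + u₂(D+3lo−2K))`.
Degree-5 certificate, 35 products (kit j298271/j298285). [this work] -/
theorem ltTop4_costRho_two (lo K g₁ g₂ g₃ D : ℝ) (hlo : 0 < lo)
    (hK1 : 7 * lo ≤ 2 * K) (hK2 : K ≤ 4 * lo) (hg₁ : lo ≤ K * g₁) (hg₃ : lo ≤ K * g₃) (h11 : g₁ ≤ 1) (h21 : g₂ ≤ 1)
    (h31 : g₃ ≤ 1) (hD2' : 2 * K ≤ D) (hDL' : D ≤ K * (g₁ + g₂ + g₃) - 3 * lo) :
    (3 * K - 3 * lo - D) * D * ((1 - g₁) * (1 - g₂) * (1 - g₃) + (g₁ * (1 - g₂) * (1 - g₃) + g₂ * (1 - g₁) * (1 - g₃) + g₃ * (1 - g₁) * (1 - g₂)))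
      ≤ (3 * K - D) * ((1 - g₁) * (1 - g₂) * (1 - g₃) * (D + 3 * lo) + (g₁ * (1 - g₂) * (1 - g₃) + g₂ * (1 - g₁) * (1 - g₃) + g₃ * (1 - g₁) * (1
          - g₂)) * (D + 3 * lo - K) + (g₁ * g₂ * (1 - g₃) + g₁ * g₃ * (1 - g₂) + g₂ * g₃ * (1 - g₁)) * (D + 3 * lo - 2 * K)) := by
  have hK : 0 < K := by linarith
  have hA1 : 0 ≤ K * g₁ - lo := sub_nonneg.2 hg₁
  have hA3 : 0 ≤ K * g₃ - lo := sub_nonneg.2 hg₃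
  have hE1 : 0 ≤ 1 - g₁ := sub_nonneg.2 h11
  have hE2 : 0 ≤ 1 - g₂ := sub_nonneg.2 h21
  have hE3 : 0 ≤ 1 - g₃ := sub_nonneg.2 h31
  have hClo : 0 ≤ 4 * lo - K := by linarith
  have hD2 : 0 ≤ D - 2 * K := by linarith
  have hDL : 0 ≤ K * (g₁ + g₂ + g₃) - 3 * lo - D := sub_nonneg.2 hDL'
  have key : 0 ≤ ((3 * K - D) * ((1 - g₁) * (1 - g₂) * (1 - g₃) * (D + 3 * lo) + (g₁ * (1 - g₂) * (1 - g₃) + g₂ * (1 - g₁) * (1 - g₃) + g₃ * (1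
          - g₁) * (1 - g₂)) * (D + 3 * lo - K) + (g₁ * g₂ * (1 - g₃) + g₁ * g₃ * (1 - g₂) + g₂ * g₃ * (1 - g₁)) * (D + 3 * lo - 2 * K))
      - ((3 * K - 3 * lo - D) * D * ((1 - g₁) * (1 - g₂) * (1 - g₃) + (g₁ * (1 - g₂) * (1 - g₃) + g₂ * (1 - g₁) * (1 - g₃) + g₃ * (1 - g₁) * (1
          - g₂))))) := by
    linarith [mul_nonneg (mul_nonneg hE3 hK.le) hK.le,
      mul_nonneg (mul_nonneg hE3 hD2) hDL,
      mul_nonneg (mul_nonneg hE3 hClo) hK.le,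
      mul_nonneg (mul_nonneg (mul_nonneg hE3 hE3) hD2) hK.le,
      mul_nonneg (mul_nonneg hE2 hK.le) hK.le,
      mul_nonneg (mul_nonneg hE2 hD2) hDL,
      mul_nonneg (mul_nonneg hE2 hClo) hK.le,
      mul_nonneg (mul_nonneg (mul_nonneg hE2 hE3) hD2) hK.le,
      mul_nonneg (mul_nonneg (mul_nonneg hE2 hE3) hD2) hD2,
      mul_nonneg (mul_nonneg (mul_nonneg hE2 hE3) hClo) hK.le,
      mul_nonneg (mul_nonneg (mul_nonneg hE2 hE3) hClo) hD2,
      mul_nonneg (mul_nonneg (mul_nonneg hE2 hE2) hD2) hK.le,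
      mul_nonneg (mul_nonneg hE1 hK.le) hK.le,
      mul_nonneg (mul_nonneg hE1 hD2) hDL,
      mul_nonneg (mul_nonneg hE1 hClo) hK.le,
      mul_nonneg (mul_nonneg (mul_nonneg hE1 hE3) hD2) hK.le,
      mul_nonneg (mul_nonneg (mul_nonneg hE1 hE3) hD2) hD2,
      mul_nonneg (mul_nonneg (mul_nonneg hE1 hE3) hClo) hK.le,
      mul_nonneg (mul_nonneg (mul_nonneg hE1 hE3) hClo) hD2,
      mul_nonneg (mul_nonneg (mul_nonneg hE1 hE2) hD2) hK.le,
      mul_nonneg (mul_nonneg (mul_nonneg hE1 hE2) hD2) hD2,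
      mul_nonneg (mul_nonneg (mul_nonneg hE1 hE2) hClo) hK.le,
      mul_nonneg (mul_nonneg (mul_nonneg hE1 hE2) hClo) hD2,
      mul_nonneg (mul_nonneg (mul_nonneg (mul_nonneg hE1 hE2) hE3) hDL) hK.le,
      mul_nonneg (mul_nonneg (mul_nonneg (mul_nonneg hE1 hE2) hE3) hD2) hDL,
      mul_nonneg (mul_nonneg (mul_nonneg (mul_nonneg (mul_nonneg hE1 hE2) hE3) hE3) hK.le) hK.le,
      mul_nonneg (mul_nonneg (mul_nonneg (mul_nonneg (mul_nonneg hE1 hE2) hE3) hE3) hD2) hK.le,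
      mul_nonneg (mul_nonneg (mul_nonneg (mul_nonneg (mul_nonneg hE1 hE2) hE2) hE3) hK.le) hK.le,
      mul_nonneg (mul_nonneg (mul_nonneg (mul_nonneg (mul_nonneg hE1 hE2) hE2) hE3) hD2) hK.le,
      mul_nonneg (mul_nonneg (mul_nonneg hE1 hE1) hD2) hK.le,
      mul_nonneg (mul_nonneg (mul_nonneg (mul_nonneg (mul_nonneg hE1 hE1) hE2) hE3) hK.le) hK.le,
      mul_nonneg (mul_nonneg (mul_nonneg (mul_nonneg (mul_nonneg hE1 hE1) hE2) hE3) hD2) hK.le,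
      mul_nonneg (mul_nonneg hA3 hE2) hK.le,
      mul_nonneg (mul_nonneg hA3 hE1) hK.le,
      mul_nonneg (mul_nonneg hA1 hE2) hK.le]
  linarith [key]

end LawDec
end Quant
end Summit.CriticalPhenomena.PercolationContinuityZ3.Theorems
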